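import Literature.NumberTheory.DiophantineGeometry.TensorPowerCommutant
import Literature.Computability.AlgebraicComplexity.OrbitClosureProofs
import Mathlib.LinearAlgebra.Matrix.GeneralLinearGroup.MvPolynomial
import Mathlib.LinearAlgebra.Matrix.Trace
import Mathlib.Algebra.CharZero.Infinite
import Mathlib.Algebra.Polynomial.Roots
import HarnessLib

/-!
# Pair-word polynomials: matrix coefficients of `V^{⊗D}` as polynomials on matrix space
(trunk ArithGeomL / CplxAlg; infrastructure for the Kronecker bound
`orbitMultiplicity_det_le_kroneckerCoeff` of `SchurWeylPlethysm`)

For a finite alphabet `σ`, words `I J : Fin D → σ` and a coefficient matrix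
`L : Matrix (Fin D → σ) (Fin D → σ) k`, the *pair-word polynomial*
`pairPoly L = ∑_{I,J} L_{I J} ∏_j X_{(I j, J j)} ∈ k[X_{a b} : a, b ∈ σ]`
is the polynomial function `A ↦ ∑_{I,J} L_{I J} (A^{⊗D})_{I J} = tr (Lᵀ A^{⊗D})` on the matrix
space `Mat_σ(k)`, where `A^{⊗D} = kronPow A`, `(A^{⊗D})_{I J} = ∏_j A_{I j, J j}`, is the `D`-th
Kronecker power (the matrix of `A` acting diagonally on `(k^σ)^{⊗D}` in the word basis,
cf. `tensorPowerMatrix` of `TensorWordModel` for `σ = Fin N`). These are exactly the matrix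
coefficients of the representation `V^{⊗D}`, `V = k^σ`, viewed as polynomials of degree `D`.
This file records the elementary "Peter–Weyl in degree `D`" facts used to bound multiplicities
in coordinate rings of orbit closures:

* every homogeneous polynomial of degree `D` on `Mat_σ` is a `pairPoly L`
  (`exists_pairPoly_eq_of_isHomogeneous`), and `L` may be taken invariant under the simultaneous
  permutation of the positions of both words (`exists_isPermInvariant_pairPoly_eq`, averaging over
  `𝔖_D`, characteristic zero);
* on such invariant `L` the map `L ↦ pairPoly L` is injective
  (`eq_zero_of_isPermInvariant_of_pairPoly_eq_zero`: the coefficient of a monomial is the sum of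
  the entries of `L` over an `𝔖_D`-orbit of pairs of words, `coeff_functionalPoly` and
  `exists_perm_of_sum_single_pair_eq` of `TensorPowerCommutant` — the coordinate form of
  Fulton–Harris, Lemma 6.23);
* left and right translation of the argument are matrix multiplications of `L` by Kronecker
  powers: `pairPoly L (b A) = pairPoly ((b^{⊗D})ᵀ L)(A)`, `pairPoly L (A h) = pairPoly (L (h^{⊗D})ᵀ)(A)`
  (`eval_pairPoly_mul_left`, `eval_pairPoly_mul_right`), so that semi-invariance of the
  polynomial function under translations becomes, for invariant `L`, an eigen-equation for the
  columns, resp. rows, of `L` (`kronPow_transpose_mul_eq_of_eval_mul_left`,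
  `mul_kronPow_transpose_eq_of_eval_mul_right`; `GL_σ(k)` is Zariski dense in `Mat_σ`,
  Mathlib's `MvPolynomial.eq_of_eval_eq_on_gl`);
* a polynomial on `Mat_σ` with `P(t g) = t^D P(g)` for all `g ∈ GL_σ(k)`, `t ∈ kˣ` (`k` infinite)
  is homogeneous of degree `D` (`isHomogeneous_of_eval_smul_eq`).

## Sources

* W. Fulton, J. Harris, *Representation Theory. A First Course*, GTM 129 (1991), §6.1–§6.2
  (Lemma 6.23: the commutant of `𝔖_d` on `V^{⊗d}` is spanned by `GL(V)`; its proof identifies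
  `Sym^d(End V)` with the span of the `g^{⊗d}`), §4.3 and §15.3 (matrix coefficients).
  [cite: FultonHarrisGTM129, Lemma 6.23]
* R. Goodman, N. Wallach, *Symmetry, Representations, and Invariants*, GTM 255 (2009), §4.2.4
  (matrix coefficients / regular functions of degree `d` on `GL_n`), Thm. 4.2.7 (algebraic
  Peter–Weyl). [folklore]
* P. Bürgisser, J. M. Landsberg, L. Manivel, J. Weyman, *An overview of mathematical issues
  arising in the geometric complexity theory approach to VP ≠ VNP*, SIAM J. Comput. 40 (2011),
  §5.2 (the use made of these facts downstream). [cite: BLMW2011, §5.2]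

## Mathlib and tree

Used: `MvPolynomial.eq_of_eval_eq_on_gl`, `MvPolynomial.homogeneousComponent`
(`sum_homogeneousComponent`, `homogeneousComponent_eq_zero`,
`homogeneousComponent_isHomogeneous`), `Polynomial.eq_zero_of_infinite_isRoot`,
`Matrix.trace` (`trace_mul_cycle`), `Matrix.submatrix` (`submatrix_mul_equiv`,
`submatrix_submatrix`), `Finsupp.toMultiset` (`Finsupp.card_toMultiset`,
`Multiset.sum_map_singleton`), `MvPolynomial.as_sum`,
`MvPolynomial.IsHomogeneous.degree_eq_sum_deg_support`, the `CharZero → Infinite` instance of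
`Mathlib.Algebra.CharZero.Infinite`. From the tree: `eval_functionalPoly`, `coeff_functionalPoly`,
`prod_X_pair_eq_monomial`, `exists_perm_of_sum_single_pair_eq` (`TensorPowerCommutant`);
`eval_smul_of_isHomogeneous` (`OrbitClosureProofs`); `tensorPowerMatrix` (`TensorWordModel`, the
`Fin N` case of `kronPow`, `kronPow_eq_tensorPowerMatrix`). Mathlib has no matrix coefficients of tensor powers as
polynomials and no Peter–Weyl theorem.

## Design

Everything lives in `namespace Literature.CplxAlg`; the Kronecker powers and permutation invariance are
stated over a commutative ring `k` (as `tensorPowerMatrix`), the pair-word polynomials over a field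
`k`, for a `Fintype` alphabet `σ` (with
`DecidableEq` where monomials are compared) and a word length `D`; characteristic zero is
assumed exactly where the averaging over `𝔖_D` or the orbit count needs it, `[Infinite k]` where
density of `GL_σ(k)` in `Mat_σ` is used. `pairPoly` is bundled as a `k`-linear map. The
`𝔖_D`-action on coefficient matrices is `L ↦ L.submatrix (compPerm τ) (compPerm τ)` with
`compPerm τ I = I ∘ τ`, so that Mathlib's `submatrix` algebra applies.
-/

noncomputable section

open MvPolynomial
open scoped BigOperators Matrix

namespace Literature.NumberTheory.DiophantineGeometry

section Basic

variable {k : Type*} [CommRing k] {σ : Type*} {D : ℕ}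

/-! ### Kronecker powers of a matrix, indexed by words -/

/-- The `D`-th Kronecker power `A^{⊗D}` of a square matrix `A` over the alphabet `σ`, indexed by
words `Fin D → σ`: entry `(I, J)` is `∏_j A_{I j, J j}` (the matrix of the diagonal action of `A`
on `(k^σ)^{⊗D}` in the word basis; for `σ = Fin N` this is `tensorPowerMatrix` of
`TensorWordModel`). Fulton–Harris §6.1; Goodman–Wallach §4.2.4. [folklore] -/
def kronPow (A : Matrix σ σ k) : Matrix (Fin D → σ) (Fin D → σ) k :=
  Matrix.of fun I J => ∏ j, A (I j) (J j)

/-- Entries of the Kronecker power (unfolding lemma). [folklore] -/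
@[simp]
theorem kronPow_apply (A : Matrix σ σ k) (I J : Fin D → σ) :
    kronPow A I J = ∏ j, A (I j) (J j) :=
  rfl

/-- For the alphabet `Fin N`, `kronPow` is `tensorPowerMatrix` of `TensorWordModel` (same
definition, both over commutative rings; recorded so that `tensorPowerMatrix` may later be
retired to an abbreviation). [folklore] -/
theorem kronPow_eq_tensorPowerMatrix {N : ℕ} (A : Matrix (Fin N) (Fin N) k) :
    kronPow (D := D) A = tensorPowerMatrix k N D A :=
  rfl

/-- The Kronecker power is multiplicative: `(A B)^{⊗D} = A^{⊗D} B^{⊗D}`. [folklore] -/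
theorem kronPow_mul [Fintype σ] (A B : Matrix σ σ k) :
    kronPow (D := D) (A * B) = kronPow A * kronPow B := by
  ext I J
  simp only [kronPow_apply, Matrix.mul_apply]
  rw [Fintype.prod_sum]
  refine Finset.sum_congr rfl fun K _ => ?_
  rw [Finset.prod_mul_distrib]

/-- The Kronecker power of the identity is the identity. [folklore] -/
theorem kronPow_one [DecidableEq σ] : kronPow (D := D) (1 : Matrix σ σ k) = 1 := by
  ext I J
  rw [kronPow_apply, Matrix.one_apply]
  by_cases h : I = J
  · subst h
    simp
  · obtain ⟨p, hp⟩ := Function.ne_iff.1 h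
    rw [if_neg h]
    exact Finset.prod_eq_zero (Finset.mem_univ p) (Matrix.one_apply_ne hp)

/-- The Kronecker power of a transpose is the transpose of the Kronecker power. [folklore] -/
theorem kronPow_transpose (A : Matrix σ σ k) : kronPow (D := D) Aᵀ = (kronPow A)ᵀ := by
  ext I J
  rfl

/-- The Kronecker power of a scalar multiple: `(t A)^{⊗D} = t^D A^{⊗D}`. [folklore] -/
theorem kronPow_smul (t : k) (A : Matrix σ σ k) :
    kronPow (D := D) (t • A) = t ^ D • kronPow A := by
  ext I J
  simp only [kronPow_apply, Matrix.smul_apply, smul_eq_mul, Finset.prod_mul_distrib,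
    Finset.prod_const, Finset.card_univ, Fintype.card_fin]

/-! ### The simultaneous permutation of positions -/

/-- Precomposition of words with a permutation of the positions, `I ↦ I ∘ τ`, as a permutation
of the set of words. [folklore] -/
def compPerm (τ : Equiv.Perm (Fin D)) : (Fin D → σ) ≃ (Fin D → σ) where
  toFun I := I ∘ τ
  invFun I := I ∘ τ.symm
  left_inv I := by
    funext j
    simp
  right_inv I := by
    funext j
    simp

/-- Unfolding lemma for `compPerm`. [folklore] -/
@[simp]
theorem compPerm_apply (τ : Equiv.Perm (Fin D)) (I : Fin D → σ) : compPerm τ I = I ∘ τ :=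
  rfl

/-- `compPerm` turns products of permutations into composition in the opposite order:
`compPerm τ (compPerm τ' I) = compPerm (τ' * τ) I`. [folklore] -/
theorem compPerm_compPerm (τ τ' : Equiv.Perm (Fin D)) (I : Fin D → σ) :
    compPerm τ (compPerm τ' I) = compPerm (σ := σ) (τ' * τ) I :=
  rfl

/-- Kronecker powers are invariant under the simultaneous permutation of the positions of both
words. [folklore] -/
theorem kronPow_submatrix_compPerm (A : Matrix σ σ k) (τ : Equiv.Perm (Fin D)) :
    (kronPow A).submatrix (compPerm τ) (compPerm τ) = kronPow (D := D) A := by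
  ext I J
  simp only [Matrix.submatrix_apply, kronPow_apply, compPerm_apply, Function.comp_apply]
  exact Equiv.prod_comp τ (fun j => A (I j) (J j))

/-- A coefficient matrix `L` indexed by pairs of words is *permutation invariant* if
`L_{I∘τ, J∘τ} = L_{I J}` for every permutation `τ` of the positions (these are the matrices of
the endomorphisms of `(k^σ)^{⊗D}` commuting with `𝔖_D`, Fulton–Harris §6.2). [folklore] -/
def IsPermInvariant (L : Matrix (Fin D → σ) (Fin D → σ) k) : Prop :=
  ∀ τ : Equiv.Perm (Fin D), L.submatrix (compPerm τ) (compPerm τ) = L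

omit [CommRing k] in
/-- Entrywise form of permutation invariance. [folklore] -/
theorem IsPermInvariant.apply_comp {L : Matrix (Fin D → σ) (Fin D → σ) k}
    (hL : IsPermInvariant L) (τ : Equiv.Perm (Fin D)) (I J : Fin D → σ) :
    L (I ∘ τ) (J ∘ τ) = L I J := by
  have h := congr_fun (congr_fun (hL τ) I) J
  rwa [Matrix.submatrix_apply] at h

/-- Kronecker powers are permutation invariant. [folklore] -/
theorem isPermInvariant_kronPow (A : Matrix σ σ k) : IsPermInvariant (kronPow (D := D) A) :=
  fun τ => kronPow_submatrix_compPerm A τ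

/-- Permutation invariant matrices form a subspace: zero. [folklore] -/
theorem isPermInvariant_zero : IsPermInvariant (0 : Matrix (Fin D → σ) (Fin D → σ) k) :=
  fun _ => rfl

/-- Permutation invariant matrices form a subspace: sums. [folklore] -/
theorem IsPermInvariant.add {L L' : Matrix (Fin D → σ) (Fin D → σ) k} (hL : IsPermInvariant L)
    (hL' : IsPermInvariant L') : IsPermInvariant (L + L') := fun τ => by
  ext I J
  simp only [Matrix.submatrix_apply, Matrix.add_apply, compPerm_apply, hL.apply_comp,
    hL'.apply_comp]

/-- Permutation invariant matrices form a subspace: differences. [folklore] -/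
theorem IsPermInvariant.sub {L L' : Matrix (Fin D → σ) (Fin D → σ) k} (hL : IsPermInvariant L)
    (hL' : IsPermInvariant L') : IsPermInvariant (L - L') := fun τ => by
  ext I J
  simp only [Matrix.submatrix_apply, Matrix.sub_apply, compPerm_apply, hL.apply_comp,
    hL'.apply_comp]

/-- Permutation invariant matrices form a subspace: scalar multiples. [folklore] -/
theorem IsPermInvariant.smul {L : Matrix (Fin D → σ) (Fin D → σ) k} (hL : IsPermInvariant L)
    (c : k) : IsPermInvariant (c • L) := fun τ => by
  ext I J
  simp only [Matrix.submatrix_apply, Matrix.smul_apply, compPerm_apply, hL.apply_comp]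

/-- Permutation invariant matrices form a subalgebra: products. [folklore] -/
theorem IsPermInvariant.mul [Fintype σ] {L L' : Matrix (Fin D → σ) (Fin D → σ) k}
    (hL : IsPermInvariant L)
    (hL' : IsPermInvariant L') : IsPermInvariant (L * L') := fun τ => by
  rw [← Matrix.submatrix_mul_equiv L L' _ (compPerm τ) _, hL τ, hL' τ]

omit [CommRing k] in
/-- Permutation invariance is stable under transposition. [folklore] -/
theorem IsPermInvariant.transpose {L : Matrix (Fin D → σ) (Fin D → σ) k}
    (hL : IsPermInvariant L) : IsPermInvariant Lᵀ := fun τ => by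
  rw [← Matrix.transpose_submatrix, hL τ]

/-- Sums of permutation invariant matrices are permutation invariant. [folklore] -/
theorem isPermInvariant_sum {ι : Type*} (s : Finset ι)
    {L : ι → Matrix (Fin D → σ) (Fin D → σ) k} (hL : ∀ i ∈ s, IsPermInvariant (L i)) :
    IsPermInvariant (∑ i ∈ s, L i) := by
  classical
  induction s using Finset.induction_on with
  | empty =>
    rw [Finset.sum_empty]
    exact isPermInvariant_zero
  | insert a s ha ih =>
    rw [Finset.sum_insert ha]
    exact (hL a (Finset.mem_insert_self a s)).add (ih fun i hi => hL i (Finset.mem_insert_of_mem hi))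

end Basic

section Poly

variable {k : Type*} [Field k] {σ : Type*} [Fintype σ] {D : ℕ}

/-! ### Pair-word polynomials -/

variable (k σ D) in
/-- The **pair-word polynomial** of a coefficient matrix `L`:
`pairPoly L = ∑_{I,J} L_{I J} ∏_j X_{(I j, J j)}`, a polynomial on the matrix space `Mat_σ` whose
value at `A` is `∑_{I,J} L_{I J} (A^{⊗D})_{I J}` (`eval_pairPoly_matrix`); bundled as a `k`-linear
map. These are the matrix coefficients of `(k^σ)^{⊗D}` (Fulton–Harris §6.2, proof of Lemma 6.23;
Goodman–Wallach §4.2.4). [folklore] -/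
def pairPoly : Matrix (Fin D → σ) (Fin D → σ) k →ₗ[k] MvPolynomial (σ × σ) k where
  toFun L := ∑ I : Fin D → σ, ∑ J : Fin D → σ, C (L I J) * ∏ j, X (I j, J j)
  map_add' L L' := by
    simp only [Matrix.add_apply, map_add, add_mul, Finset.sum_add_distrib]
  map_smul' c L := by
    simp only [Matrix.smul_apply, smul_eq_mul, map_mul, RingHom.id_apply, Finset.smul_sum,
      smul_eq_C_mul, mul_assoc]

/-- Unfolding lemma for `pairPoly`. [folklore] -/
theorem pairPoly_apply (L : Matrix (Fin D → σ) (Fin D → σ) k) :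
    pairPoly k σ D L = ∑ I : Fin D → σ, ∑ J : Fin D → σ, C (L I J) * ∏ j, X (I j, J j) :=
  rfl

/-- Values of a pair-word polynomial: `pairPoly L (x) = ∑_{I,J} L_{I J} ∏_j x_{(I j, J j)}`.
[folklore] -/
theorem eval_pairPoly (L : Matrix (Fin D → σ) (Fin D → σ) k) (x : σ × σ → k) :
    eval x (pairPoly k σ D L) = ∑ I, ∑ J, L I J * ∏ j, x (I j, J j) :=
  eval_functionalPoly L x

/-- Values of a pair-word polynomial at a matrix: `∑_{I,J} L_{I J} (A^{⊗D})_{I J}`. [folklore] -/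
theorem eval_pairPoly_matrix (L : Matrix (Fin D → σ) (Fin D → σ) k) (A : Matrix σ σ k) :
    eval (fun ij : σ × σ => A ij.1 ij.2) (pairPoly k σ D L) = ∑ I, ∑ J, L I J * kronPow A I J :=
  eval_functionalPoly L _

/-- Values of a pair-word polynomial at a matrix as a trace: `pairPoly L (A) = tr (Lᵀ A^{⊗D})`.
Goodman–Wallach §4.2.4 (matrix coefficients `g ↦ tr(L g)`). [folklore] -/
theorem eval_pairPoly_eq_trace (L : Matrix (Fin D → σ) (Fin D → σ) k) (A : Matrix σ σ k) :
    eval (fun ij : σ × σ => A ij.1 ij.2) (pairPoly k σ D L) = Matrix.trace (Lᵀ * kronPow A) := by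
  rw [eval_pairPoly_matrix, Matrix.trace, Finset.sum_comm]
  refine Finset.sum_congr rfl fun J _ => ?_
  rw [Matrix.diag_apply, Matrix.mul_apply]
  rfl

/-- **Left translation.** `pairPoly L (b A) = pairPoly ((b^{⊗D})ᵀ L) (A)`: translating the
argument on the left multiplies the coefficient matrix by the transposed Kronecker power.
Goodman–Wallach §4.2.4. [folklore] -/
theorem eval_pairPoly_mul_left (L : Matrix (Fin D → σ) (Fin D → σ) k) (b A : Matrix σ σ k) :
    eval (fun ij : σ × σ => (b * A) ij.1 ij.2) (pairPoly k σ D L) =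
      eval (fun ij : σ × σ => A ij.1 ij.2) (pairPoly k σ D ((kronPow b)ᵀ * L)) := by
  rw [eval_pairPoly_eq_trace, eval_pairPoly_eq_trace, kronPow_mul, Matrix.transpose_mul,
    Matrix.transpose_transpose, Matrix.mul_assoc]

/-- **Right translation.** `pairPoly L (A h) = pairPoly (L (h^{⊗D})ᵀ) (A)`.
Goodman–Wallach §4.2.4. [folklore] -/
theorem eval_pairPoly_mul_right (L : Matrix (Fin D → σ) (Fin D → σ) k) (A h : Matrix σ σ k) :
    eval (fun ij : σ × σ => (A * h) ij.1 ij.2) (pairPoly k σ D L) =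
      eval (fun ij : σ × σ => A ij.1 ij.2) (pairPoly k σ D (L * (kronPow h)ᵀ)) := by
  rw [eval_pairPoly_eq_trace, eval_pairPoly_eq_trace, kronPow_mul, Matrix.transpose_mul,
    Matrix.transpose_transpose, ← Matrix.mul_assoc, Matrix.trace_mul_cycle]

/-- **Scalars.** `pairPoly L (t A) = t^D pairPoly L (A)`: pair-word polynomials are homogeneous
of degree `D`. [folklore] -/
theorem eval_pairPoly_smul (L : Matrix (Fin D → σ) (Fin D → σ) k) (t : k) (A : Matrix σ σ k) :
    eval (fun ij : σ × σ => (t • A) ij.1 ij.2) (pairPoly k σ D L) =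
      t ^ D * eval (fun ij : σ × σ => A ij.1 ij.2) (pairPoly k σ D L) := by
  rw [eval_pairPoly_eq_trace, eval_pairPoly_eq_trace, kronPow_smul, Matrix.mul_smul,
    Matrix.trace_smul, smul_eq_mul]

/-- Pair-word polynomials are homogeneous of degree `D`. [folklore] -/
theorem pairPoly_isHomogeneous (L : Matrix (Fin D → σ) (Fin D → σ) k) :
    (pairPoly k σ D L).IsHomogeneous D := by
  rw [pairPoly_apply]
  refine IsHomogeneous.sum _ _ _ fun I _ => IsHomogeneous.sum _ _ _ fun J _ => ?_
  have h := (isHomogeneous_C (σ := σ × σ) (L I J)).mul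
    (IsHomogeneous.prod Finset.univ (fun j => (X (I j, J j) : MvPolynomial (σ × σ) k))
      (fun _ => 1) fun j _ => isHomogeneous_X k (I j, J j))
  simpa using h

/-- The pair-word polynomial only depends on the `𝔖_D`-average of the coefficient matrix:
`pairPoly (L ∘ (τ, τ)) = pairPoly L`. Fulton–Harris §6.2. [folklore] -/
theorem pairPoly_submatrix_compPerm (L : Matrix (Fin D → σ) (Fin D → σ) k)
    (τ : Equiv.Perm (Fin D)) :
    pairPoly k σ D (L.submatrix (compPerm τ) (compPerm τ)) = pairPoly k σ D L := by
  rw [pairPoly_apply, pairPoly_apply]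
  have hm : ∀ I J : Fin D → σ, (∏ j, X (I j, J j) : MvPolynomial (σ × σ) k) =
      ∏ j, X ((compPerm τ I) j, (compPerm τ J) j) := fun I J =>
    (Equiv.prod_comp τ (fun j => (X (I j, J j) : MvPolynomial (σ × σ) k))).symm
  refine Fintype.sum_equiv (compPerm τ) _ _ fun I => ?_
  refine Fintype.sum_equiv (compPerm τ) _ _ fun J => ?_
  rw [Matrix.submatrix_apply, hm I J]

/-! ### Averaging over `𝔖_D` -/

variable (k σ D) in
/-- The `𝔖_D`-average `(1/D!) ∑_τ L ∘ (τ, τ)` of a coefficient matrix (meaningful in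
characteristic zero). Fulton–Harris §6.2 (projection onto the commutant of `𝔖_D`). [folklore] -/
def permAverage (L : Matrix (Fin D → σ) (Fin D → σ) k) : Matrix (Fin D → σ) (Fin D → σ) k :=
  (Fintype.card (Equiv.Perm (Fin D)) : k)⁻¹ •
    ∑ τ : Equiv.Perm (Fin D), L.submatrix (compPerm τ) (compPerm τ)

omit [Fintype σ] in
/-- The average is permutation invariant. [folklore] -/
theorem isPermInvariant_permAverage (L : Matrix (Fin D → σ) (Fin D → σ) k) :
    IsPermInvariant (permAverage k σ D L) := by
  intro τ
  ext I J
  simp only [permAverage, Matrix.submatrix_apply, Matrix.smul_apply, Matrix.sum_apply,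
    compPerm_apply]
  congr 1
  exact Fintype.sum_equiv (Equiv.mulLeft τ) _ _ fun τ' => rfl

/-- In characteristic zero the average has the same pair-word polynomial. [folklore] -/
theorem pairPoly_permAverage [CharZero k] (L : Matrix (Fin D → σ) (Fin D → σ) k) :
    pairPoly k σ D (permAverage k σ D L) = pairPoly k σ D L := by
  rw [permAverage, map_smul, map_sum]
  simp only [pairPoly_submatrix_compPerm, Finset.sum_const, Finset.card_univ]
  rw [← Nat.cast_smul_eq_nsmul k, smul_smul, inv_mul_cancel₀, one_smul]
  exact Nat.cast_ne_zero.mpr Fintype.card_ne_zero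

/-! ### Injectivity on invariant coefficient matrices -/

/-- **Injectivity of `pairPoly` on invariant matrices** (characteristic zero): the coefficient of
the monomial of a pair `(I₀, J₀)` in `pairPoly L` is the sum of the entries of `L` over the
`𝔖_D`-orbit of `(I₀, J₀)` (`coeff_functionalPoly`, `exists_perm_of_sum_single_pair_eq`), i.e.
`|orbit| · L_{I₀ J₀}` for invariant `L`. Fulton–Harris, proof of Lemma 6.23.
[cite: FultonHarrisGTM129, Lemma 6.23] -/
theorem eq_zero_of_isPermInvariant_of_pairPoly_eq_zero [DecidableEq σ] [CharZero k]
    {L : Matrix (Fin D → σ) (Fin D → σ) k} (hL : IsPermInvariant L)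
    (h0 : pairPoly k σ D L = 0) : L = 0 := by
  ext I₀ J₀
  have hcoeff := coeff_functionalPoly L I₀ J₀
  change coeff _ (pairPoly k σ D L) = _ at hcoeff
  rw [h0, coeff_zero] at hcoeff
  set s := (Finset.univ : Finset ((Fin D → σ) × (Fin D → σ))).filter
    (fun p => (∑ j, Finsupp.single (p.1 j, p.2 j) (1 : ℕ)) =
      ∑ j, Finsupp.single (I₀ j, J₀ j) (1 : ℕ)) with hs
  have hconst : ∀ p ∈ s, L p.1 p.2 = L I₀ J₀ := by
    intro p hp
    obtain ⟨τ, h1, h2⟩ := exists_perm_of_sum_single_pair_eq (Finset.mem_filter.mp hp).2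
    rw [h1, h2, hL.apply_comp]
  rw [Finset.sum_congr rfl hconst, Finset.sum_const, nsmul_eq_mul] at hcoeff
  have hcard : (s.card : k) ≠ 0 := by
    rw [Nat.cast_ne_zero, ← Nat.pos_iff_ne_zero, Finset.card_pos]
    exact ⟨(I₀, J₀), Finset.mem_filter.mpr ⟨Finset.mem_univ _, rfl⟩⟩
  rw [Matrix.zero_apply]
  exact (mul_eq_zero.mp hcoeff.symm).resolve_left hcard

/-- Two invariant coefficient matrices with the same pair-word polynomial are equal
(characteristic zero). Fulton–Harris, Lemma 6.23. [cite: FultonHarrisGTM129, Lemma 6.23] -/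
theorem eq_of_isPermInvariant_of_pairPoly_eq [DecidableEq σ] [CharZero k]
    {L L' : Matrix (Fin D → σ) (Fin D → σ) k} (hL : IsPermInvariant L)
    (hL' : IsPermInvariant L') (h : pairPoly k σ D L = pairPoly k σ D L') : L = L' := by
  rw [← sub_eq_zero]
  exact eq_zero_of_isPermInvariant_of_pairPoly_eq_zero (hL.sub hL') (by rw [map_sub, h, sub_self])

/-! ### Translation semi-invariance as eigen-equations -/

/-- **Left semi-invariance.** If `L` is permutation invariant and the polynomial function
`pairPoly L` satisfies `pairPoly L (b g) = c · pairPoly L (g)` for all `g ∈ GL_σ(k)` (`k` of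
characteristic zero, hence infinite), then `(b^{⊗D})ᵀ L = c L`: density of `GL_σ(k)` in `Mat_σ`
(`MvPolynomial.eq_of_eval_eq_on_gl`), the translation formula `eval_pairPoly_mul_left` and
injectivity on invariant matrices. Goodman–Wallach §4.2.4; Fulton–Harris Lemma 6.23. [folklore] -/
theorem kronPow_transpose_mul_eq_of_eval_mul_left [DecidableEq σ] [CharZero k]
    {L : Matrix (Fin D → σ) (Fin D → σ) k} (hL : IsPermInvariant L) (b : Matrix σ σ k) (c : k)
    (h : ∀ g : GL σ k,
      eval (fun ij : σ × σ => (b * (g : Matrix σ σ k)) ij.1 ij.2) (pairPoly k σ D L) =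
        c * eval (fun ij : σ × σ => (g : Matrix σ σ k) ij.1 ij.2) (pairPoly k σ D L)) :
    (kronPow b)ᵀ * L = c • L := by
  refine eq_of_isPermInvariant_of_pairPoly_eq ((isPermInvariant_kronPow b).transpose.mul hL)
    (hL.smul c) ?_
  apply MvPolynomial.eq_of_eval_eq_on_gl
  intro g
  rw [← eval_pairPoly_mul_left, h g, map_smul, smul_eval]

/-- **Right invariance.** If `L` is permutation invariant and `pairPoly L (g h) = pairPoly L (g)`
for all `g ∈ GL_σ(k)` (characteristic zero), then `L (h^{⊗D})ᵀ = L`.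
Goodman–Wallach §4.2.4. [folklore] -/
theorem mul_kronPow_transpose_eq_of_eval_mul_right [DecidableEq σ] [CharZero k]
    {L : Matrix (Fin D → σ) (Fin D → σ) k} (hL : IsPermInvariant L) (h : Matrix σ σ k)
    (hh : ∀ g : GL σ k,
      eval (fun ij : σ × σ => ((g : Matrix σ σ k) * h) ij.1 ij.2) (pairPoly k σ D L) =
        eval (fun ij : σ × σ => (g : Matrix σ σ k) ij.1 ij.2) (pairPoly k σ D L)) :
    L * (kronPow h)ᵀ = L := by
  refine eq_of_isPermInvariant_of_pairPoly_eq (hL.mul (isPermInvariant_kronPow h).transpose) hL ?_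
  apply MvPolynomial.eq_of_eval_eq_on_gl
  intro g
  rw [← eval_pairPoly_mul_right, hh g]

/-! ### Every homogeneous polynomial of degree `D` is a pair-word polynomial -/

omit [Fintype σ] in
/-- A monomial exponent of degree `D` on `σ × σ` is enumerated by a word of length `D` in the
alphabet `σ × σ` (list the multiset of its variables). [folklore] -/
theorem exists_sum_single_eq_of_degree_eq [DecidableEq σ] (s : σ × σ →₀ ℕ) (hs : s.degree = D) :
    ∃ IJ : Fin D → σ × σ, ∑ j, Finsupp.single (IJ j) (1 : ℕ) = s := by
  set l := (Finsupp.toMultiset s).toList with hl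
  have hlen : l.length = D := by
    rw [hl, Multiset.length_toList, Finsupp.card_toMultiset, ← hs, Finsupp.degree_apply]
    rfl
  refine ⟨fun j => l.get (Fin.cast hlen.symm j), ?_⟩
  have h1 : ∑ j : Fin D, Finsupp.single (l.get (Fin.cast hlen.symm j)) (1 : ℕ) =
      ∑ i : Fin l.length, Finsupp.single (l.get i) 1 :=
    Fintype.sum_equiv (finCongr hlen.symm) _ _ fun _ => rfl
  rw [h1, ← List.sum_ofFn]
  have h2 : List.ofFn (fun i : Fin l.length => Finsupp.single (l.get i) (1 : ℕ)) =
      l.map fun x => Finsupp.single x 1 := by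
    conv_rhs => rw [← List.ofFn_get l]
    rw [List.map_ofFn]
    rfl
  rw [h2]
  have h4 : (fun x : σ × σ => (Finsupp.single x (1 : ℕ))) =
      (⇑Multiset.toFinsupp ∘ fun x : σ × σ => ({x} : Multiset (σ × σ))) := by
    funext x
    exact (Multiset.toFinsupp_singleton x).symm
  rw [h4, ← List.map_map, ← map_list_sum, ← Multiset.sum_coe, ← Multiset.map_coe, hl,
    Multiset.coe_toList, Multiset.sum_map_singleton, Finsupp.toMultiset_toFinsupp]

/-- The pair-word polynomial of a single-entry matrix is the corresponding monomial:
`pairPoly (c E_{I J}) = c ∏_j X_{(I j, J j)}`. [folklore] -/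
theorem pairPoly_single [DecidableEq σ] (I J : Fin D → σ) (c : k) :
    pairPoly k σ D (Matrix.single I J c) = C c * ∏ j, X (I j, J j) := by
  rw [pairPoly_apply, Finset.sum_eq_single I, Finset.sum_eq_single J]
  · rw [Matrix.single_apply_same]
  · intro J' _ hJ'
    rw [Matrix.single_apply_of_col_ne I I (Ne.symm hJ'), map_zero, zero_mul]
  · exact fun h => absurd (Finset.mem_univ J) h
  · intro I' _ hI'
    refine Finset.sum_eq_zero fun J' _ => ?_
    rw [Matrix.single_apply_of_row_ne (Ne.symm hI') J J', map_zero, zero_mul]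
  · exact fun h => absurd (Finset.mem_univ I) h

/-- **Every homogeneous polynomial of degree `D` on `Mat_σ` is a pair-word polynomial** (each
monomial of degree `D` is a product of `D` matrix entries, `exists_sum_single_eq_of_degree_eq`
and `prod_X_pair_eq_monomial`). Goodman–Wallach §4.2.4 (`O[Mat_n]_d` is spanned by the matrix
coefficients of `V^{⊗d}`); Fulton–Harris §6.2. [folklore] -/
theorem exists_pairPoly_eq_of_isHomogeneous [DecidableEq σ] (P : MvPolynomial (σ × σ) k)
    (hP : P.IsHomogeneous D) : ∃ L : Matrix (Fin D → σ) (Fin D → σ) k, pairPoly k σ D L = P := by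
  classical
  choose IJ hIJ using fun s (hs : s ∈ P.support) =>
    exists_sum_single_eq_of_degree_eq (D := D) s
      (by rw [Finsupp.degree_apply]; exact (hP.degree_eq_sum_deg_support hs).symm)
  refine ⟨∑ s ∈ P.support.attach,
    Matrix.single (fun j => (IJ s.1 s.2 j).1) (fun j => (IJ s.1 s.2 j).2) (coeff s.1 P), ?_⟩
  rw [map_sum]
  conv_rhs => rw [as_sum P, ← Finset.sum_attach]
  refine Finset.sum_congr rfl fun s _ => ?_
  rw [pairPoly_single, prod_X_pair_eq_monomial]
  simp only [Prod.mk.eta]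
  rw [hIJ s.1 s.2, C_mul_monomial, mul_one]

/-- In characteristic zero every homogeneous polynomial of degree `D` on `Mat_σ` is the pair-word
polynomial of a **permutation invariant** coefficient matrix (average the matrix of
`exists_pairPoly_eq_of_isHomogeneous` over `𝔖_D`). Fulton–Harris §6.2. [folklore] -/
theorem exists_isPermInvariant_pairPoly_eq [DecidableEq σ] [CharZero k]
    (P : MvPolynomial (σ × σ) k) (hP : P.IsHomogeneous D) :
    ∃ L : Matrix (Fin D → σ) (Fin D → σ) k, IsPermInvariant L ∧ pairPoly k σ D L = P := by
  obtain ⟨L, hL⟩ := exists_pairPoly_eq_of_isHomogeneous P hP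
  exact ⟨permAverage k σ D L, isPermInvariant_permAverage L, by rw [pairPoly_permAverage, hL]⟩

/-! ### Homogeneity from scalar semi-invariance -/

/-- **Homogeneity from scalar semi-invariance.** A polynomial `P` on the matrix space `Mat_σ`
over an infinite field with `P(t g) = t^D P(g)` for every `g ∈ GL_σ(k)` and every `t ≠ 0` is
homogeneous of degree `D`: for fixed `g` the univariate polynomial
`∑_e P_e(g) T^e - P(g) T^D` (`P_e` the homogeneous components) has infinitely many roots, so
`P_e(g) = 0` for `e ≠ D`, and `P_e = 0` by density of `GL_σ(k)`
(`MvPolynomial.eq_of_eval_eq_on_gl`). Green, LNM 830, §2.2 (degree = weight of the centre);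
Goodman–Wallach §4.2.4. [folklore] -/
theorem isHomogeneous_of_eval_smul_eq [DecidableEq σ] [Infinite k] (P : MvPolynomial (σ × σ) k)
    (h : ∀ (g : GL σ k) (t : k), t ≠ 0 →
      eval (fun ij : σ × σ => (t • (g : Matrix σ σ k)) ij.1 ij.2) P =
        t ^ D * eval (fun ij : σ × σ => (g : Matrix σ σ k) ij.1 ij.2) P) :
    P.IsHomogeneous D := by
  classical
  -- every homogeneous component of degree `e ≠ D` vanishes
  have key : ∀ e, e ≠ D → homogeneousComponent e P = 0 := by
    intro e he
    apply MvPolynomial.eq_of_eval_eq_on_gl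
    intro g
    rw [map_zero]
    set x : σ × σ → k := fun ij => (g : Matrix σ σ k) ij.1 ij.2 with hx
    set N := P.totalDegree + 1 with hN
    set a : ℕ → k := fun i => eval x (homogeneousComponent i P) with ha
    -- the univariate polynomial `∑_i a_i T^i - (∑_i a_i) T^D`
    set F : Polynomial k := ∑ i ∈ Finset.range N, Polynomial.C (a i) * Polynomial.X ^ i -
      Polynomial.C (eval x P) * Polynomial.X ^ D with hF
    have hroot : ∀ t : k, t ≠ 0 → F.IsRoot t := by
      intro t ht
      have hsum : eval (fun ij : σ × σ => (t • (g : Matrix σ σ k)) ij.1 ij.2) P =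
          ∑ i ∈ Finset.range N, t ^ i * a i := by
        conv_lhs => rw [← sum_homogeneousComponent P]
        rw [map_sum]
        refine Finset.sum_congr rfl fun i _ => ?_
        rw [ha]
        have := Literature.Computability.AlgebraicComplexity.eval_smul_of_isHomogeneous (homogeneousComponent_isHomogeneous i P) t x
        rw [← this]
        rfl
      rw [Polynomial.IsRoot, hF, Polynomial.eval_sub, Polynomial.eval_finsetSum]
      simp only [Polynomial.eval_mul, Polynomial.eval_C, Polynomial.eval_pow, Polynomial.eval_X]
      rw [sub_eq_zero, mul_comm (eval x P), ← h g t ht, hsum]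
      exact Finset.sum_congr rfl fun i _ => mul_comm _ _
    have hF0 : F = 0 := by
      apply Polynomial.eq_zero_of_infinite_isRoot
      apply Set.Infinite.mono (s := {t : k | t ≠ 0})
      · intro t ht
        exact hroot t ht
      · exact (Set.finite_singleton (0 : k)).infinite_compl
    have hcoeff := congrArg (fun Q : Polynomial k => Q.coeff e) hF0
    simp only [hF, Polynomial.coeff_sub, Polynomial.coeff_zero, Polynomial.finsetSum_coeff,
      Polynomial.coeff_C_mul, Polynomial.coeff_X_pow, mul_ite, mul_one, mul_zero,
      if_neg he, sub_zero] at hcoeff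
    rw [Finset.sum_ite_eq] at hcoeff
    by_cases heN : e < N
    · rw [if_pos (Finset.mem_range.mpr heN)] at hcoeff
      exact hcoeff
    · have h0 : homogeneousComponent e P = 0 := homogeneousComponent_eq_zero e P (by omega)
      change eval x (homogeneousComponent e P) = 0
      rw [h0, map_zero]
  -- hence `P` equals its component of degree `D`
  have hP : P = homogeneousComponent D P := by
    conv_lhs => rw [← sum_homogeneousComponent P]
    rw [Finset.sum_eq_single D]
    · intro e _ he
      exact key e he
    · intro hD
      rw [homogeneousComponent_eq_zero _ _ (by
        rw [Finset.mem_range, not_lt] at hD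
        omega)]
  rw [hP]
  exact homogeneousComponent_isHomogeneous D P

end Poly

end Literature.NumberTheory.DiophantineGeometry
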